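import Summits.Ventures.YMGap.RobustBall.StarFarLoadsZd
import HarnessLib

/-!
# Venture YMGap, track ROBUST-BALL (Y2) — crux Y2-X2-WZd, step 4: the TILT COMPARISON (two kernels tilted by
# two nearby star-local weights)

HONEST FRAMING. WHAT THIS IS: a venture file (cell `pub-ymgap`, track Y2 ROBUST-BALL, seat ds-2); one
measure-theoretic inequality. Two probability measures `μ₁, μ₂` on the configurations of `ℤ^d` are close on
star-local Lipschitz observables (`|μ₁ g − μ₂ g| ≤ Σ_{x ∈ ⋆} δ'_x A_x`, the window contraction of the NEAR kernels);
`h₁` is a star-local weight exponent with `|h₁| ≤ τ` and link-Lipschitz vector `ℓ`, `h₂` any measurable exponent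
with `|h₂| ≤ τ` and `|h₁ − h₂| ≤ 2u` (the normalised FAR energies at two exteriors). Then the tilted expectations of
a star-local `f` with `|f| ≤ F` and Lipschitz vector `δ` satisfy
`|μ₁(e^{−h₁} f)/μ₁(e^{−h₁}) − μ₂(e^{−h₂} f)/μ₂(e^{−h₂})| ≤ E² Σ δ_x A_x + F (E² + E⁴) Σ ℓ_x A_x + 2uF(E² + E⁴)`,
`E = e^τ` (`tilt_comparison`) — the inequality that turns the near window contraction plus the far-energy bounds
into the window contraction of the tier-2 kernels (`RobustStarDoorZdW.lean`). WHAT THIS IS NOT: no door, no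
number; nothing about the continuum or the Millennium problem.
-/

noncomputable section

open MeasureTheory Function Finset Real
open scoped NNReal
open Literature.Probability.LatticeModels
open Literature.Probability.LatticeModels.DobrushinMetric
open Literature.MathematicalPhysics.QuantumLattice
open Literature.MathematicalPhysics.QuantumFieldTheory hiding ZdEdge

namespace Summit.Ventures.YMGap.RobustBall

variable {d N : ℕ}

/-- Two integrals against the same probability measure of functions at uniform distance `≤ c` differ by at most
`c`. [folklore] -/
private theorem abs_integral_sub_integral_le_of_forall_le {μ : Measure (LGConfig d (SUN N))} [IsProbabilityMeasure μ]
    {g g' : LGConfig d (SUN N) → ℝ} (hg : Integrable g μ) (hg' : Integrable g' μ) {c : ℝ}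
    (h : ∀ σ, |g σ - g' σ| ≤ c) : |∫ σ, g σ ∂μ - ∫ σ, g' σ ∂μ| ≤ c := by
  rw [← integral_sub hg hg']
  calc |∫ σ, (g σ - g' σ) ∂μ| ≤ ∫ σ, |g σ - g' σ| ∂μ := abs_integral_le_integral_abs
    _ ≤ ∫ _σ, c ∂μ := integral_mono (hg.sub hg').abs (integrable_const c) h
    _ = c := by simp

/-- **THE TILT COMPARISON.** See the module docstring. [folklore] -/
theorem tilt_comparison {S : Finset (ZdEdge d)} {r : SUN N → SUN N → ℝ}
    {μ₁ μ₂ : Measure (LGConfig d (SUN N))} [IsProbabilityMeasure μ₁] [IsProbabilityMeasure μ₂]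
    {A : ZdEdge d → ℝ}
    (hnear : ∀ (g : LGConfig d (SUN N) → ℝ) (δ' : ZdEdge d → ℝ), Measurable g → (∃ B, ∀ σ, |g σ| ≤ B) →
      DependsOn g (S : Set (ZdEdge d)) → (∀ x, 0 ≤ δ' x) →
      (∀ (x : ZdEdge d) (σ τ : LGConfig d (SUN N)), (∀ v, v ≠ x → σ v = τ v) →
        |g σ - g τ| ≤ δ' x * r (σ x) (τ x)) →
        |∫ σ, g σ ∂μ₁ - ∫ σ, g σ ∂μ₂| ≤ ∑ x ∈ S, δ' x * A x)
    {f : LGConfig d (SUN N) → ℝ} (hfm : Measurable f) {F : ℝ} (hF0 : 0 ≤ F) (hfF : ∀ σ, |f σ| ≤ F)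
    (hfdep : DependsOn f (S : Set (ZdEdge d))) {δ : ZdEdge d → ℝ} (hδ0 : ∀ x, 0 ≤ δ x)
    (hδ : ∀ (x : ZdEdge d) (σ τ : LGConfig d (SUN N)), (∀ v, v ≠ x → σ v = τ v) →
      |f σ - f τ| ≤ δ x * r (σ x) (τ x))
    {h₁ h₂ : LGConfig d (SUN N) → ℝ} (hh₁m : Measurable h₁) (hh₂m : Measurable h₂) {τ : ℝ}
    (hτ₁ : ∀ σ, |h₁ σ| ≤ τ) (hτ₂ : ∀ σ, |h₂ σ| ≤ τ) (hh₁dep : DependsOn h₁ (S : Set (ZdEdge d)))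
    {ℓ : ZdEdge d → ℝ} (hℓ0 : ∀ x, 0 ≤ ℓ x)
    (hℓ : ∀ (x : ZdEdge d) (σ τ' : LGConfig d (SUN N)), (∀ v, v ≠ x → σ v = τ' v) →
      |h₁ σ - h₁ τ'| ≤ ℓ x * r (σ x) (τ' x))
    {u : ℝ} (hu : ∀ σ, |h₁ σ - h₂ σ| ≤ 2 * u) :
    |(∫ σ, exp (-h₁ σ) * f σ ∂μ₁) / (∫ σ, exp (-h₁ σ) ∂μ₁) -
        (∫ σ, exp (-h₂ σ) * f σ ∂μ₂) / (∫ σ, exp (-h₂ σ) ∂μ₂)| ≤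
      exp τ ^ 2 * ∑ x ∈ S, δ x * A x + F * (exp τ ^ 2 + exp τ ^ 4) * ∑ x ∈ S, ℓ x * A x +
        2 * u * F * (exp τ ^ 2 + exp τ ^ 4) := by
  have hτ0 : 0 ≤ τ := (abs_nonneg _).trans (hτ₁ (fun _ => 1))
  set E : ℝ := exp τ with hE
  have hE0 : 0 < E := exp_pos τ
  -- the weights and their bounds
  have he_le : ∀ {h : LGConfig d (SUN N) → ℝ}, (∀ σ, |h σ| ≤ τ) → ∀ σ, exp (-h σ) ≤ E := fun hh σ =>
    exp_le_exp.2 (by linarith [(abs_le.1 (hh σ)).1])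
  have he_ge : ∀ {h : LGConfig d (SUN N) → ℝ}, (∀ σ, |h σ| ≤ τ) → ∀ σ, exp (-τ) ≤ exp (-h σ) := fun hh σ =>
    exp_le_exp.2 (by linarith [(abs_le.1 (hh σ)).2])
  have he_abs : ∀ {h : LGConfig d (SUN N) → ℝ}, (∀ σ, |h σ| ≤ τ) → ∀ σ, |exp (-h σ)| ≤ E := fun hh σ => by
    rw [abs_of_pos (exp_pos _)]; exact he_le hh σ
  have hef_abs : ∀ {h : LGConfig d (SUN N) → ℝ}, (∀ σ, |h σ| ≤ τ) → ∀ σ, |exp (-h σ) * f σ| ≤ E * F :=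
    fun hh σ => by rw [abs_mul]; exact mul_le_mul (he_abs hh σ) (hfF σ) (abs_nonneg _) hE0.le
  -- measurability / integrability
  have hme : ∀ {h : LGConfig d (SUN N) → ℝ}, Measurable h → Measurable fun σ => exp (-h σ) :=
    fun hh => hh.neg.exp
  have hmef : ∀ {h : LGConfig d (SUN N) → ℝ}, Measurable h → Measurable fun σ => exp (-h σ) * f σ :=
    fun hh => (hme hh).mul hfm
  have hie : ∀ {h : LGConfig d (SUN N) → ℝ} (hh : Measurable h) (hb : ∀ σ, |h σ| ≤ τ) (μ : Measure (LGConfig d (SUN N)))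
      [IsProbabilityMeasure μ], Integrable (fun σ => exp (-h σ)) μ :=
    fun hh hb μ _ => integrable_of_abs_le' (hme hh) (he_abs hb)
  have hief : ∀ {h : LGConfig d (SUN N) → ℝ} (hh : Measurable h) (hb : ∀ σ, |h σ| ≤ τ)
      (μ : Measure (LGConfig d (SUN N))) [IsProbabilityMeasure μ], Integrable (fun σ => exp (-h σ) * f σ) μ :=
    fun hh hb μ _ => integrable_of_abs_le' (hmef hh) (hef_abs hb)
  -- Lipschitz vectors of `e₁ = e^{-h₁}` and `g₁ = e₁ f`
  have hlip_e : ∀ (x : ZdEdge d) (σ τ' : LGConfig d (SUN N)), (∀ v, v ≠ x → σ v = τ' v) →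
      |exp (-h₁ σ) - exp (-h₁ τ')| ≤ E * ℓ x * r (σ x) (τ' x) := by
    intro x σ τ' hστ
    have h1 := abs_exp_sub_exp_le (a := -h₁ σ) (b := -h₁ τ') (τ := τ)
      (by linarith [(abs_le.1 (hτ₁ σ)).1]) (by linarith [(abs_le.1 (hτ₁ τ')).1])
    have h2 : |(-h₁ σ) - (-h₁ τ')| = |h₁ σ - h₁ τ'| := by rw [← abs_neg]; ring_nf
    rw [h2] at h1
    calc |exp (-h₁ σ) - exp (-h₁ τ')| ≤ exp τ * |h₁ σ - h₁ τ'| := h1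
      _ ≤ exp τ * (ℓ x * r (σ x) (τ' x)) := mul_le_mul_of_nonneg_left (hℓ x σ τ' hστ) hE0.le
      _ = E * ℓ x * r (σ x) (τ' x) := by rw [hE]; ring
  have hlip_g : ∀ (x : ZdEdge d) (σ τ' : LGConfig d (SUN N)), (∀ v, v ≠ x → σ v = τ' v) →
      |exp (-h₁ σ) * f σ - exp (-h₁ τ') * f τ'| ≤ E * (δ x + F * ℓ x) * r (σ x) (τ' x) := by
    intro x σ τ' hστ
    have h1 : exp (-h₁ σ) * f σ - exp (-h₁ τ') * f τ' =
        exp (-h₁ σ) * (f σ - f τ') + f τ' * (exp (-h₁ σ) - exp (-h₁ τ')) := by ring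
    rw [h1]
    refine (abs_add_le _ _).trans ?_
    rw [abs_mul, abs_mul]
    calc |exp (-h₁ σ)| * |f σ - f τ'| + |f τ'| * |exp (-h₁ σ) - exp (-h₁ τ')|
        ≤ E * (δ x * r (σ x) (τ' x)) + F * (E * ℓ x * r (σ x) (τ' x)) :=
          add_le_add (mul_le_mul (he_abs hτ₁ σ) (hδ x σ τ' hστ) (abs_nonneg _) hE0.le)
            (mul_le_mul (hfF τ') (hlip_e x σ τ' hστ) (abs_nonneg _) hF0)
      _ = E * (δ x + F * ℓ x) * r (σ x) (τ' x) := by ring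
  -- the near comparison for `g₁` and `e₁`
  have hdep_e : DependsOn (fun σ => exp (-h₁ σ)) (S : Set (ZdEdge d)) := fun σ τ' h => by
    simp only; rw [hh₁dep h]
  have hdep_g : DependsOn (fun σ => exp (-h₁ σ) * f σ) (S : Set (ZdEdge d)) := fun σ τ' h => by
    simp only; rw [hh₁dep h, hfdep h]
  have hA_g := hnear (fun σ => exp (-h₁ σ) * f σ) (fun x => E * (δ x + F * ℓ x)) (hmef hh₁m)
    ⟨E * F, hef_abs hτ₁⟩ hdep_g (fun x => mul_nonneg hE0.le (add_nonneg (hδ0 x) (mul_nonneg hF0 (hℓ0 x)))) hlip_g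
  have hA_e := hnear (fun σ => exp (-h₁ σ)) (fun x => E * ℓ x) (hme hh₁m) ⟨E, he_abs hτ₁⟩ hdep_e
    (fun x => mul_nonneg hE0.le (hℓ0 x)) hlip_e
  -- changing the weight from `h₁` to `h₂` under `μ₂`
  have hsw_g : ∀ σ, |exp (-h₁ σ) * f σ - exp (-h₂ σ) * f σ| ≤ F * E * (2 * u) := by
    intro σ
    have h1 := abs_exp_sub_exp_le (a := -h₁ σ) (b := -h₂ σ) (τ := τ)
      (by linarith [(abs_le.1 (hτ₁ σ)).1]) (by linarith [(abs_le.1 (hτ₂ σ)).1])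
    have h2 : |(-h₁ σ) - (-h₂ σ)| = |h₁ σ - h₂ σ| := by rw [← abs_neg]; ring_nf
    rw [h2] at h1
    rw [← sub_mul, abs_mul, mul_comm]
    calc |f σ| * |exp (-h₁ σ) - exp (-h₂ σ)| ≤ F * (exp τ * (2 * u)) :=
          mul_le_mul (hfF σ) (h1.trans (mul_le_mul_of_nonneg_left (hu σ) (exp_pos _).le)) (abs_nonneg _) hF0
      _ = F * E * (2 * u) := by rw [hE]; ring
  have hsw_e : ∀ σ, |exp (-h₁ σ) - exp (-h₂ σ)| ≤ E * (2 * u) := by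
    intro σ
    have h1 := abs_exp_sub_exp_le (a := -h₁ σ) (b := -h₂ σ) (τ := τ)
      (by linarith [(abs_le.1 (hτ₁ σ)).1]) (by linarith [(abs_le.1 (hτ₂ σ)).1])
    have h2 : |(-h₁ σ) - (-h₂ σ)| = |h₁ σ - h₂ σ| := by rw [← abs_neg]; ring_nf
    rw [h2] at h1
    exact h1.trans (mul_le_mul_of_nonneg_left (hu σ) (exp_pos _).le)
  -- the four numbers
  set a₁ := ∫ σ, exp (-h₁ σ) * f σ ∂μ₁
  set a₂ := ∫ σ, exp (-h₂ σ) * f σ ∂μ₂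
  set b₁ := ∫ σ, exp (-h₁ σ) ∂μ₁
  set b₂ := ∫ σ, exp (-h₂ σ) ∂μ₂
  have hA : |a₁ - a₂| ≤ ∑ x ∈ S, E * (δ x + F * ℓ x) * A x + F * E * (2 * u) := by
    calc |a₁ - a₂| ≤ |a₁ - ∫ σ, exp (-h₁ σ) * f σ ∂μ₂| + |∫ σ, exp (-h₁ σ) * f σ ∂μ₂ - a₂| := abs_sub_le _ _ _
      _ ≤ _ := add_le_add hA_g (abs_integral_sub_integral_le_of_forall_le (hief hh₁m hτ₁ μ₂) (hief hh₂m hτ₂ μ₂) hsw_g)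
  have hB : |b₁ - b₂| ≤ ∑ x ∈ S, E * ℓ x * A x + E * (2 * u) := by
    calc |b₁ - b₂| ≤ |b₁ - ∫ σ, exp (-h₁ σ) ∂μ₂| + |∫ σ, exp (-h₁ σ) ∂μ₂ - b₂| := abs_sub_le _ _ _
      _ ≤ _ := add_le_add hA_e (abs_integral_sub_integral_le_of_forall_le (hie hh₁m hτ₁ μ₂) (hie hh₂m hτ₂ μ₂) hsw_e)
  have hb₁ : exp (-τ) ≤ b₁ := by
    calc exp (-τ) = ∫ _σ, exp (-τ) ∂μ₁ := by simp
      _ ≤ b₁ := integral_mono (integrable_const _) (hie hh₁m hτ₁ μ₁) (he_ge hτ₁)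
  have hb₂ : exp (-τ) ≤ b₂ := by
    calc exp (-τ) = ∫ _σ, exp (-τ) ∂μ₂ := by simp
      _ ≤ b₂ := integral_mono (integrable_const _) (hie hh₂m hτ₂ μ₂) (he_ge hτ₂)
  have ha₂ : |a₂| ≤ exp τ * F := by
    calc |a₂| ≤ ∫ σ, |exp (-h₂ σ) * f σ| ∂μ₂ := abs_integral_le_integral_abs
      _ ≤ ∫ _σ, E * F ∂μ₂ := integral_mono (hief hh₂m hτ₂ μ₂).abs (integrable_const _) (hef_abs hτ₂)
      _ = exp τ * F := by simp [hE]
  have key := abs_div_sub_div_le hA hB hb₁ hb₂ ha₂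
  refine key.trans (le_of_eq ?_)
  have h3 : exp (3 * τ) = E ^ 3 := by rw [hE, ← Real.exp_nat_mul]; norm_num
  rw [h3, ← hE]
  have hsum1 : ∑ x ∈ S, E * (δ x + F * ℓ x) * A x = E * ∑ x ∈ S, δ x * A x + E * F * ∑ x ∈ S, ℓ x * A x := by
    rw [Finset.mul_sum, Finset.mul_sum, ← Finset.sum_add_distrib]
    exact Finset.sum_congr rfl fun x _ => by ring
  have hsum2 : ∑ x ∈ S, E * ℓ x * A x = E * ∑ x ∈ S, ℓ x * A x := by
    rw [Finset.mul_sum]; exact Finset.sum_congr rfl fun x _ => by ring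
  rw [hsum1, hsum2]
  ring

end Summit.Ventures.YMGap.RobustBall

end
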